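import Summits.NavierStokesRegularity.FluidComputer.PalasekTowerRegisterGlobalLetterField
import Summits.NavierStokesRegularity.FluidComputer.PalasekTowerRescaledCopy
import Summits.NavierStokesRegularity.FluidComputer.PalasekTowerHeredityWitnessCalibration

/-!
# REGISTER v2.3′: the readout letter is energetically free — an explicit witness under the ceiling

Cell `ns-blowup`, seat `ns-blowup-ecbridge-5` (g4); second half of the pair
`PalasekTowerRegisterGlobalLetterField.lean` (the field `(amp χ) J(y - c)` and its kinematics) /
this file; companion of `PalasekTowerRegisterGlobalHeredity.lean` (p415576: the halves `ContinuationEnvelope` /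
`ReadoutFloors` of the child crux `HeredityFrom 2`, item stmt-NavierStokesRegularity-19250) and
`PalasekTowerRescaledCopy.lean` (p422042: the readout predicate `Letter S m v` — the three floors
of level `m` that `ReadoutFloors` asks of a continuation at `τ m`). LABEL: E–C typing (KINEMATICS
ONLY: one explicit smooth divergence-free field and its register readings). WHAT THIS IS NOT: not
Navier–Stokes evidence — no stage, flow, tower or blow-up is constructed or asserted; the field
below is a time-slice, not a solution, and says nothing about the dynamics of any continuation.

## Why (item -19250, why-it-might-fail «energy cannot fund the floors»; refuter4 STAMP «non-vacuity»)

The lower half `ReadoutFloors` asks, at the readout `τ (k+1)` of every finite-energy classical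
continuation INSIDE the ceiling `‖u‖ ≤ c₂ Y_{k+1}`, for the three floors of level `k + 1`: the
velocity floor `c₁ Y_{k+1}` and the strain floor `c₁ A_{k+1}` at points of the ball, and the core
ledger (a `C¹` loop of speed `≤ 8π/N_{k+1}` in a ball of radius `1/N_{k+1}` with circulation
`≥ c₁ N_{k+1}^{β-2}`). Two desk questions about this target are settled here on the kinematic
side, for EVERY rate record `R`, EVERY level `m` and EVERY centre `c`:

* the target is CONSISTENT with the ceiling and with incompressibility: the cut-off solid
  rotation `v(y) = (3/2) A_m χ(y) J(y - c)` (`J = rotGen`, `χ = smoothTransition (256/31 -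
  (400/31) N_m² ‖y - c‖²)`, so `χ = 1` on `‖y - c‖ ≤ 3/(4N_m)` and `χ = 0` off
  `‖y - c‖ < 4/(5N_m)`) is `C^∞`, divergence free, supported in `closedBall c (4/(5N_m))`,
  has speed `(9/8) Y_m` on the circle of radius `3/(4N_m)`, gradient `(3/2) A_m • J` at the
  centre, circulation EXACTLY `(27π/16) N_m^{β-2}` around that circle (speed `3π/(2N_m)`), and
  sup norm `≤ (6/5) Y_m` — inside the registered ceiling `(5/3) Y_m` (`exists_letterWitness`,
  `exists_letter_le_ceiling`: `Letter S m v` by name for a rigid schedule);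
* its ENERGY is `≤ π Y_m² / N_m³ = π N_m^{2β-5}` (`= π N_m^{-2/5}` on the wide rates), which
  tends to `0` along the tower: the floors have no energy price beyond the R13 ledger, so
  «energy cannot fund the floors» is not a kinematic obstruction — whatever fails in
  `ReadoutFloors` is transport / compaction (the autonomy bet), not the register's numbers.

References: S. Palasek, arXiv:2605.13827 §3.1 (dictionary `A_k = N_k^β`, core radius `N_k^{-1}`,
circulation `N_k^{β-2}`) [cite: Palasek2026ElementaryModel, §3.1]; A. J. Majda, A. L. Bertozzi,
*Vorticity and Incompressible Flow* (CUP 2002) §1.2 (solid-body rotation), §1.6 (1.57)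
(circulation) [cite: MajdaBertozziCUP2002, §1.2].
-/

noncomputable section

namespace Summit.NavierStokesRegularity.FluidComputer.PalasekTowerClayBridge

open Set MeasureTheory Filter Topology Function Real
open scoped ENNReal ContDiff NNReal InnerProductSpace RealInnerProductSpace
open Literature.Analysis.FluidPDE
open LetterWitness

/-! ## §1 The witness for the rates `R` at level `m`: the letter inside the ceiling, energy `≤ π Y_m²/N_m³` -/

/-- **THE LETTER WITNESS** (any rates `R`, any level `m`, any centre `c`). There is a `C^∞`,
divergence-free field `v` on `ℝ³`, vanishing off the ball `‖y - c‖ < 4/(5N_m)`, with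
* sup norm `≤ (6/5) Y_m` (inside the registered ceiling `(5/3) Y_m`),
* speed EXACTLY `(9/8) Y_m` at the point `c + (3/(4N_m)) e₀` (velocity floor `Y_m`),
* `‖D v(c)‖ ≥ (3/2) A_m` (strain floor `A_m`),
* the circle of radius `3/(4N_m)` about `c` is a `C¹` closed loop inside `closedBall c (1/N_m)` of
  speed `3π/(2N_m) ≤ 8π/N_m` with circulation EXACTLY `(27π/16) N_m^{β-2}` (core floor `N_m^{β-2}`),
* energy `∫ ‖v‖² ≤ π Y_m² / N_m³`.
It is the cut-off solid rotation `(3/2) A_m χ J(y - c)`. [cite: MajdaBertozziCUP2002, §1.2] -/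
theorem exists_letterWitness (R : TowerRates) (m : ℕ) (c : EuclideanSpace ℝ (Fin 3)) :
    ∃ v : EuclideanSpace ℝ (Fin 3) → EuclideanSpace ℝ (Fin 3),
      ContDiff ℝ ∞ v ∧ VectorCalculus.IsDivFree v ∧
      (∀ y, 4 / (5 * R.N m) ≤ ‖y - c‖ → v y = 0) ∧
      (∀ y, ‖v y‖ ≤ 6 / 5 * R.Y m) ∧
      ‖v (c + (3 / (4 * R.N m)) • EuclideanSpace.single 0 1)‖ = 9 / 8 * R.Y m ∧
      3 / 2 * R.A m ≤ ‖fderiv ℝ v c‖ ∧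
      (ContDiff ℝ 1 (circleLoop c (3 / (4 * R.N m)) (EuclideanSpace.single 0 1)
          (EuclideanSpace.single 1 1)) ∧
        circleLoop c (3 / (4 * R.N m)) (EuclideanSpace.single 0 1) (EuclideanSpace.single 1 1) 0 =
          circleLoop c (3 / (4 * R.N m)) (EuclideanSpace.single 0 1) (EuclideanSpace.single 1 1) 1 ∧
        (∀ σ ∈ Icc (0 : ℝ) 1, circleLoop c (3 / (4 * R.N m)) (EuclideanSpace.single 0 1)
          (EuclideanSpace.single 1 1) σ ∈ Metric.closedBall c (1 / R.N m)) ∧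
        (∀ σ ∈ Icc (0 : ℝ) 1, ‖deriv (circleLoop c (3 / (4 * R.N m)) (EuclideanSpace.single 0 1)
          (EuclideanSpace.single 1 1)) σ‖ ≤ 8 * π / R.N m) ∧
        circulation v (circleLoop c (3 / (4 * R.N m)) (EuclideanSpace.single 0 1)
          (EuclideanSpace.single 1 1)) = 27 * π / 16 * R.N m ^ (R.β - 2)) ∧
      ∫⁻ y, ‖v y‖ₑ ^ 2 ≤ ENNReal.ofReal (π * (R.Y m ^ 2 / R.N m ^ 3)) := by
  have hN := R.N_pos m
  have hA := R.A_pos m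
  have hY : 0 < R.Y m := Real.rpow_pos_of_pos hN _
  have hAY := R.A_eq_N_mul_Y m
  set N := R.N m with hNdef
  set amp : ℝ := 3 / 2 * R.A m with hampdef
  have hamp : 0 ≤ amp := by positivity
  set a : ℝ := 256 / 31 with hadef
  set b : ℝ := 400 / 31 * N ^ 2 with hbdef
  clear_value amp a b N
  have ha : (1 : ℝ) ≤ a := by norm_num [hadef]
  -- the cut-off is `1` on `‖y - c‖ ≤ 3/(4N)` and `0` off `‖y - c‖ < 4/(5N)`
  have hρ1 : 1 ≤ a - b * (3 / (4 * N)) ^ 2 := by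
    rw [hadef, hbdef]; field_simp; norm_num
  have hcut0 : ∀ y : EuclideanSpace ℝ (Fin 3), 4 / (5 * N) ≤ ‖y - c‖ → a - b * ‖y - c‖ ^ 2 ≤ 0 := by
    intro y hy
    have h1 : (4 / (5 * N)) ^ 2 ≤ ‖y - c‖ ^ 2 := pow_le_pow_left₀ (by positivity) hy 2
    have h2 : a = b * (4 / (5 * N)) ^ 2 := by rw [hadef, hbdef]; field_simp; norm_num
    have h3 : 0 ≤ b := by rw [hbdef]; positivity
    have h4 := mul_le_mul_of_nonneg_left h1 h3
    rw [h2]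
    linarith
  refine ⟨fun y => (amp * Real.smoothTransition (a - b * ‖y - c‖ ^ 2)) • rotGen (y - c),
    contDiff_field amp a b c, isDivFree_field amp a b c, fun y hy => field_apply_of_nonpos (hcut0 y hy),
    ?_, ?_, ?_, ⟨contDiff_circleLoop _ _ _ _, ?_, ?_, ?_, ?_⟩, ?_⟩
  · -- ceiling `(6/5) Y_m`
    intro y
    beta_reduce
    by_cases hy : 4 / (5 * N) ≤ ‖y - c‖
    · rw [field_apply_of_nonpos (hcut0 y hy), norm_zero]; positivity
    · refine (norm_field_le hamp a b c y).trans ?_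
      have h1 : amp * ‖y - c‖ ≤ amp * (4 / (5 * N)) := mul_le_mul_of_nonneg_left (not_le.1 hy).le hamp
      have h2 : amp * (4 / (5 * N)) = 6 / 5 * R.Y m := by
        rw [hampdef, hAY]; field_simp; ring
      linarith
  · -- velocity floor `(9/8) Y_m` at `c + (3/(4N)) e₀`
    have h1 : c + (3 / (4 * N)) • EuclideanSpace.single (0 : Fin 3) (1 : ℝ) - c =
        (3 / (4 * N)) • EuclideanSpace.single (0 : Fin 3) (1 : ℝ) := by abel
    have h2 : ‖(3 / (4 * N)) • EuclideanSpace.single (0 : Fin 3) (1 : ℝ)‖ = 3 / (4 * N) := by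
      rw [norm_smul, Real.norm_eq_abs, abs_of_pos (by positivity)]
      simp
    have h3 : 1 ≤ a - b * ‖c + (3 / (4 * N)) • EuclideanSpace.single (0 : Fin 3) (1 : ℝ) - c‖ ^ 2 := by
      rw [h1, h2]; exact hρ1
    beta_reduce
    rw [field_apply_of_one_le h3, h1, rotGen_smul, rotGen_single_zero, norm_smul, norm_smul,
      Real.norm_eq_abs, Real.norm_eq_abs, abs_of_nonneg hamp, abs_of_pos (by positivity), hampdef, hAY]
    simp
    field_simp
    ring
  · -- strain floor `(3/2) A_m` at the centre
    beta_reduce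
    exact le_norm_fderiv_field_centre hamp ha b c
  · -- closed loop
    have h := periodic_circleLoop c (3 / (4 * N)) (EuclideanSpace.single (0 : Fin 3) (1 : ℝ))
      (EuclideanSpace.single 1 1) 0
    rw [zero_add] at h
    exact h.symm
  · -- inside `closedBall c (1/N)`
    intro σ _
    rw [Metric.mem_closedBall, dist_eq_norm, norm_circleLoop_sub_centre, abs_of_pos (by positivity)]
    rw [div_le_div_iff₀ (by positivity) hN]
    linarith
  · -- loop speed `3π/(2N) ≤ 8π/N`
    intro σ _
    rw [norm_deriv_circleLoop, abs_of_pos (by positivity)]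
    rw [show 2 * π * (3 / (4 * N)) = (3 * π / 2) / N by ring]
    exact div_le_div_of_nonneg_right (by nlinarith [Real.pi_pos]) hN.le
  · -- circulation `(27π/16) N^{β-2}`
    beta_reduce
    rw [circulation_field_circleLoop c hρ1, hampdef, hNdef, ← R.A_div_N_sq m]
    field_simp
    ring
  · -- energy `≤ π Y_m² / N_m³`
    beta_reduce
    set B : Set (EuclideanSpace ℝ (Fin 3)) := Metric.closedBall c (4 / (5 * N)) with hBdef
    have hpt : ∀ y, (‖(amp * Real.smoothTransition (a - b * ‖y - c‖ ^ 2)) • rotGen (y - c)‖ₑ) ^ 2 ≤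
        B.indicator (fun _ => ENNReal.ofReal ((6 / 5 * R.Y m) ^ 2)) y := by
      intro y
      by_cases hy : y ∈ B
      · rw [indicator_of_mem hy, ← ofReal_norm, ← ENNReal.ofReal_pow (norm_nonneg _)]
        apply ENNReal.ofReal_le_ofReal
        have hyc : ‖y - c‖ ≤ 4 / (5 * N) := by
          rw [hBdef, Metric.mem_closedBall, dist_eq_norm] at hy; exact hy
        have h1 := norm_field_le hamp a b c y
        have h2 : amp * ‖y - c‖ ≤ amp * (4 / (5 * N)) := mul_le_mul_of_nonneg_left hyc hamp
        have h3 : amp * (4 / (5 * N)) = 6 / 5 * R.Y m := by rw [hampdef, hAY]; field_simp; ring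
        exact pow_le_pow_left₀ (norm_nonneg _) (by linarith) 2
      · have hy' : 4 / (5 * N) ≤ ‖y - c‖ := by
          rw [hBdef, Metric.mem_closedBall, dist_eq_norm, not_le] at hy; exact hy.le
        rw [field_apply_of_nonpos (hcut0 y hy'), indicator_of_notMem hy]
        simp
    calc ∫⁻ y, (‖(amp * Real.smoothTransition (a - b * ‖y - c‖ ^ 2)) • rotGen (y - c)‖ₑ) ^ 2
        ≤ ∫⁻ y, B.indicator (fun _ => ENNReal.ofReal ((6 / 5 * R.Y m) ^ 2)) y := lintegral_mono hpt
      _ = ENNReal.ofReal ((6 / 5 * R.Y m) ^ 2) * volume B :=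
          lintegral_indicator_const measurableSet_closedBall _
      _ = ENNReal.ofReal ((6 / 5 * R.Y m) ^ 2 * ((4 / (5 * N)) ^ 3 * (π * 4 / 3))) := by
          rw [hBdef, EuclideanSpace.volume_closedBall_fin_three, ← ENNReal.ofReal_pow (by positivity),
            ← ENNReal.ofReal_mul (by positivity), ← ENNReal.ofReal_mul (by positivity)]
      _ ≤ ENNReal.ofReal (π * (R.Y m ^ 2 / N ^ 3)) := by
          apply ENNReal.ofReal_le_ofReal
          have h1 : (6 / 5 * R.Y m) ^ 2 * ((4 / (5 * N)) ^ 3 * (π * 4 / 3)) =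
              (9216 / 9375) * (π * (R.Y m ^ 2 / N ^ 3)) := by
            field_simp; ring
          rw [h1]
          have h2 : 0 ≤ π * (R.Y m ^ 2 / N ^ 3) := by positivity
          nlinarith

/-! ## §2 Register reading: the level-`m` LETTER under the level-`m` CEILING, confined to the ball -/

/-- **The readout letter is kinematically free under the ceiling** (rigid schedule on ANY rates:
`c₁ = 1`, `c₂ = 5/3`). For every level `m` and every centre `c` with `‖c‖ + 1/N_m ≤ radius` there
is a `C^∞` divergence-free field `v`, vanishing outside the tower's ball, with `‖v‖ ≤ c₂ Y_m`
everywhere (the level-`m` ceiling), meeting the level-`m` LETTER `Letter S m v` — velocity floor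
`c₁ Y_m`, strain floor `c₁ A_m`, and a core loop of level `m` (circle of radius `3/(4N_m)`, speed
`3π/(2N_m)`, circulation `(27π/16) N_m^{β-2} ≥ c₁ N_m^{β-2}`) — at energy `∫ ‖v‖² ≤ π N_m^{2β-5}`.
So the conclusion of `ReadoutFloors` at level `k + 1` is consistent with its ceiling hypothesis and
with incompressibility at every level, at an energy price that is one term of the (summable) R13
ledger; the open content of the lower half is dynamics, not bookkeeping. [cite: Palasek2026ElementaryModel, §3.1] -/
theorem exists_letter_le_ceiling {R : TowerRates} {S : Schedule R} (hS : S.Rigid) (m : ℕ)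
    {c : EuclideanSpace ℝ (Fin 3)} (hc : ‖c‖ + 1 / R.N m ≤ S.radius) :
    ∃ v : EuclideanSpace ℝ (Fin 3) → EuclideanSpace ℝ (Fin 3),
      ContDiff ℝ ∞ v ∧ VectorCalculus.IsDivFree v ∧
      (∀ y, S.radius < ‖y‖ → v y = 0) ∧
      (∀ y, ‖v y‖ ≤ S.c₂ * R.Y m) ∧
      ((∃ x, ‖x‖ ≤ S.radius ∧ S.c₁ * R.Y m ≤ ‖v x‖) ∧
        (∃ x, ‖x‖ ≤ S.radius ∧ S.c₁ * R.A m ≤ ‖fderiv ℝ v x‖) ∧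
        (∃ (x : EuclideanSpace ℝ (Fin 3)) (γ : ℝ → EuclideanSpace ℝ (Fin 3)),
          ‖x‖ ≤ S.radius ∧ ContDiff ℝ 1 γ ∧ γ 0 = γ 1 ∧
          (∀ σ ∈ Icc (0 : ℝ) 1, γ σ ∈ Metric.closedBall x (1 / R.N m)) ∧
          (∀ σ ∈ Icc (0 : ℝ) 1, ‖deriv γ σ‖ ≤ 8 * π / R.N m) ∧
          S.c₁ * R.N m ^ (R.β - 2) ≤ circulation v γ)) ∧
      ∫⁻ y, ‖v y‖ₑ ^ 2 ≤ ENNReal.ofReal (π * R.N m ^ (2 * R.β - 5)) := by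
  have hN := R.N_pos m
  have hA := R.A_pos m
  have hY : 0 < R.Y m := Real.rpow_pos_of_pos hN _
  have hNinv : 0 < 1 / R.N m := by positivity
  have hc0 : ‖c‖ ≤ S.radius := by linarith
  obtain ⟨v, hsm, hdiv, hsupp, hceil, hvel, hstr, ⟨hC1, hcl, hball, hspd, hcirc⟩, hE⟩ :=
    exists_letterWitness R m c
  refine ⟨v, hsm, hdiv, ?_, ?_, ⟨?_, ?_, ?_⟩, ?_⟩
  · -- confinement to the ball
    intro y hy
    apply hsupp
    have h1 : ‖y‖ - ‖c‖ ≤ ‖y - c‖ := norm_sub_norm_le y c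
    have h2 : 4 / (5 * R.N m) ≤ 1 / R.N m := by
      rw [div_le_div_iff₀ (by positivity) hN]; linarith
    linarith
  · -- the level-m ceiling `c₂ Y_m = (5/3) Y_m ≥ (6/5) Y_m`
    intro y
    refine (hceil y).trans ?_
    rw [hS.c₂_eq]
    nlinarith
  · -- velocity floor `c₁ Y_m = Y_m ≤ (9/8) Y_m`
    refine ⟨c + (3 / (4 * R.N m)) • EuclideanSpace.single 0 1, ?_, ?_⟩
    · have h1 : ‖(3 / (4 * R.N m)) • EuclideanSpace.single (0 : Fin 3) (1 : ℝ)‖ = 3 / (4 * R.N m) := by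
        rw [norm_smul, Real.norm_eq_abs, abs_of_pos (by positivity)]
        simp
      have h2 : 3 / (4 * R.N m) ≤ 1 / R.N m := by
        rw [div_le_div_iff₀ (by positivity) hN]; linarith
      exact (norm_add_le _ _).trans (by rw [h1]; linarith)
    · rw [hvel, hS.c₁_eq]; nlinarith
  · -- strain floor `c₁ A_m = A_m ≤ (3/2) A_m`
    exact ⟨c, hc0, by rw [hS.c₁_eq]; nlinarith⟩
  · -- core loop
    refine ⟨c, circleLoop c (3 / (4 * R.N m)) (EuclideanSpace.single 0 1) (EuclideanSpace.single 1 1),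
      hc0, hC1, hcl, hball, hspd, ?_⟩
    rw [hcirc, hS.c₁_eq, one_mul]
    have h1 : 0 < R.N m ^ (R.β - 2) := Real.rpow_pos_of_pos hN _
    nlinarith [Real.pi_gt_three]
  · -- energy
    rw [← R.Y_sq_div_N_cube m]; exact hE

/-- **`Letter S m v` by name** (the fc-oneshot readout predicate, p422042 = the conclusion of
`ReadoutFloors` at level `m` read on a field): under a rigid schedule on ANY rates, every level's
letter is carried by a smooth divergence-free field confined to the ball, inside that level's
ceiling, at energy `≤ π N_m^{2β-5}`. [cite: Palasek2026ElementaryModel, §3.1] -/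
theorem exists_letter_of_rigid {S : Schedule TowerRates.wide} (hS : S.Rigid) (m : ℕ)
    {c : EuclideanSpace ℝ (Fin 3)} (hc : ‖c‖ + 1 / TowerRates.wide.N m ≤ S.radius) :
    ∃ v : EuclideanSpace ℝ (Fin 3) → EuclideanSpace ℝ (Fin 3),
      ContDiff ℝ ∞ v ∧ VectorCalculus.IsDivFree v ∧
      (∀ y, S.radius < ‖y‖ → v y = 0) ∧
      (∀ y, ‖v y‖ ≤ S.c₂ * TowerRates.wide.Y m) ∧
      Letter S m v ∧
      ∫⁻ y, ‖v y‖ₑ ^ 2 ≤ ENNReal.ofReal (π * TowerRates.wide.N m ^ (-(2 / 5 : ℝ))) := by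
  obtain ⟨v, hsm, hdiv, hsupp, hceil, hletter, hE⟩ := exists_letter_le_ceiling hS m hc
  refine ⟨v, hsm, hdiv, hsupp, hceil, hletter, ?_⟩
  have h : 2 * TowerRates.wide.β - 5 = -(2 / 5 : ℝ) := by
    simp only [TowerRates.wide]; norm_num
  rw [← h]; exact hE

/-! ## §3 The energy price of all letters is summable (R13 for the readout targets) -/

/-- **The energy price of the whole tower of letters is finite**: `Σ_m π N_m^{2β-5} < ∞`
(`2β - 5 < 0` by the energy window `β < 1 + √2 < 5/2`, DC4 / R13). [cite: Palasek2026ElementaryModel, §3 (3.2)] -/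
theorem TowerRates.summable_letter_energy (R : TowerRates) :
    Summable (fun m : ℕ => π * R.N m ^ (2 * R.β - 5)) := by
  have hβ : 2 * R.β - 5 < 0 := by
    have h1 := R.β_lt_one_add_sqrt_two
    have h2 : Real.sqrt 2 < 3 / 2 := by
      rw [Real.sqrt_lt' (by norm_num)]; norm_num
    linarith
  have h := (R.summable_N_rpow_neg (γ := -(2 * R.β - 5)) (by linarith)).mul_left π
  simpa using h


/-- The scales do not decrease from one level to the next (`N_{k+1} = N_k^b`, `N_k > 1`, `b > 1`).
[cite: Palasek2026ElementaryModel, §1.2] -/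
theorem TowerRates.N_le_N_succ (R : TowerRates) (k : ℕ) : R.N k ≤ R.N (k + 1) := by
  rw [R.N_succ k]
  conv_lhs => rw [← Real.rpow_one (R.N k)]
  exact Real.rpow_le_rpow_of_exponent_le (R.one_lt_N k).le R.one_lt_b.le

/-- The scales are monotone in the level. [cite: Palasek2026ElementaryModel, §1.2] -/
theorem TowerRates.monotone_N (R : TowerRates) : Monotone R.N :=
  monotone_nat_of_le_succ R.N_le_N_succ

/-- **The energy price BY VALUE** (wide rates): at every level `m ≥ 2` — the levels whose letters
`ReadoutFloors` asks for — the witness' energy bound is `π N_m^{-2/5} ≤ π N₂^{-2/5} < 0.22`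
(`N₂ ∈ (820, 821)`, `820^{2/5} > 1000/69`, `π < 3.15`). For comparison, the level-2 ceiling speed is
`(5/3) Y₂ ∈ (10231, 10234)` and the unit ball has volume `4π/3`. [folklore] -/
theorem wide_letter_energy_lt {m : ℕ} (hm : 2 ≤ m) :
    π * TowerRates.wide.N m ^ (-(2 / 5 : ℝ)) < 0.22 := by
  have hN2 : 820 < TowerRates.wide.N 2 := TowerRates.wide_N_two_bounds.1
  have hNm : TowerRates.wide.N 2 ≤ TowerRates.wide.N m := TowerRates.wide.monotone_N hm
  have h20 : 0 < TowerRates.wide.N 2 := by linarith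
  have h1 : TowerRates.wide.N m ^ (-(2 / 5 : ℝ)) ≤ TowerRates.wide.N 2 ^ (-(2 / 5 : ℝ)) :=
    Real.rpow_le_rpow_of_nonpos h20 hNm (by norm_num)
  have h2 : TowerRates.wide.N 2 ^ (-(2 / 5 : ℝ)) < 69 / 1000 := by
    set t : ℝ := TowerRates.wide.N 2 ^ (2 / 5 : ℝ) with ht
    have htpos : 0 < t := Real.rpow_pos_of_pos h20 _
    have ht5 : t ^ 5 = TowerRates.wide.N 2 ^ 2 := by
      rw [ht, ← Real.rpow_natCast, ← Real.rpow_mul h20.le]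
      norm_num
    have hsq : (820 : ℝ) ^ 2 < TowerRates.wide.N 2 ^ 2 := pow_lt_pow_left₀ hN2 (by norm_num) two_ne_zero
    have hlow : (1000 / 69 : ℝ) < t := by
      refine lt_of_pow_lt_pow_left₀ 5 htpos.le ?_
      rw [ht5]
      have h3 : ((1000 : ℝ) / 69) ^ 5 < (820 : ℝ) ^ 2 := by norm_num
      linarith
    have hinv : TowerRates.wide.N 2 ^ (-(2 / 5 : ℝ)) = t⁻¹ := by
      rw [ht, Real.rpow_neg h20.le]
    rw [hinv, inv_lt_comm₀ htpos (by norm_num)]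
    have h69 : ((69 : ℝ) / 1000)⁻¹ = 1000 / 69 := by norm_num
    rw [h69]
    exact hlow
  have h3 : π * TowerRates.wide.N m ^ (-(2 / 5 : ℝ)) ≤ π * TowerRates.wide.N 2 ^ (-(2 / 5 : ℝ)) :=
    mul_le_mul_of_nonneg_left h1 Real.pi_pos.le
  have h4 : π * TowerRates.wide.N 2 ^ (-(2 / 5 : ℝ)) < 3.15 * (69 / 1000) :=
    mul_lt_mul'' Real.pi_lt_d2 h2 Real.pi_pos.le
      (Real.rpow_nonneg h20.le _)
  linarith


/-! ## §4 Design note for the repair menu (refuter4 K57-W): round circles vs a flux clause at `1/N_j` -/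

/-- **Circulation vanishes around every circle on which the cut-off is off** (`a - b ρ² ≤ 0`: the field
is zero on `circleLoop c ρ e₀ e₁`). [cite: MajdaBertozziCUP2002, §1.6 eq. (1.57)] -/
theorem LetterWitness.circulation_field_circleLoop_eq_zero {amp a b ρ : ℝ}
    (c : EuclideanSpace ℝ (Fin 3)) (hρ : a - b * ρ ^ 2 ≤ 0) :
    circulation (fun y : EuclideanSpace ℝ (Fin 3) =>
        (amp * Real.smoothTransition (a - b * ‖y - c‖ ^ 2)) • rotGen (y - c))
      (circleLoop c ρ (EuclideanSpace.single 0 1) (EuclideanSpace.single 1 1)) = 0 := by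
  unfold circulation
  have hint : ∀ s : ℝ, ⟪(amp * Real.smoothTransition (a - b *
      ‖circleLoop c ρ (EuclideanSpace.single 0 1) (EuclideanSpace.single 1 1) s - c‖ ^ 2)) •
        rotGen (circleLoop c ρ (EuclideanSpace.single 0 1) (EuclideanSpace.single 1 1) s - c),
      deriv (circleLoop c ρ (EuclideanSpace.single 0 1) (EuclideanSpace.single 1 1)) s⟫ = 0 := by
    intro s
    have h1 : a - b *
        ‖circleLoop c ρ (EuclideanSpace.single 0 1) (EuclideanSpace.single 1 1) s - c‖ ^ 2 ≤ 0 := by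
      rw [LetterWitness.norm_circleLoop_sub_centre, sq_abs]; exact hρ
    rw [LetterWitness.field_apply_of_nonpos h1, inner_zero_left]
  simp_rw [hint]
  simp

/-- **The witness against the two candidate repairs of the core clause** (refuter4 K57-W: the registered
`CoreLedger` pins no winding number; repairs (r2) «winding-one ROUND circles of radius in
`[1/(2N_j), 1/N_j]`» or a FLUX clause «`∫_D ω·n ≥ c₁ N_j^{β-2}` through THE disc of radius `1/N_j`»).
The letter witness of `exists_letterWitness` (the cut-off solid rotation `(3/2)A_m χ J(y - c)`,
`χ = smoothTransition (256/31 - (400/31) N_m² ‖y - c‖²)`) meets (r2) verbatim — the round once-traversed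
circle of radius `3/(4N_m) ∈ [1/(2N_m), 1/N_m]` carries TRUE circulation `(27π/16) N_m^{β-2} ≥ N_m^{β-2}`
— but has circulation EXACTLY `0` around the circle of radius `1/N_m`
(it vanishes there: `4/5 ≤ 1`), i.e. zero vorticity flux through the disc of radius `1/N_m` by Stokes: a
flux clause pinned AT radius `1/N_j` would exclude every core confined strictly inside that radius, the
radius-RANGE form (r2) does not. Planner's call; numbers only. [cite: Palasek2026ElementaryModel, §3.1] -/
theorem letterWitness_repairs (R : TowerRates) (m : ℕ) (c : EuclideanSpace ℝ (Fin 3)) :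
    1 / (2 * R.N m) ≤ 3 / (4 * R.N m) ∧ 3 / (4 * R.N m) ≤ 1 / R.N m ∧
    circulation (fun y : EuclideanSpace ℝ (Fin 3) =>
        ((3 / 2 * R.A m) * Real.smoothTransition (256 / 31 - 400 / 31 * R.N m ^ 2 * ‖y - c‖ ^ 2)) •
          rotGen (y - c))
      (circleLoop c (3 / (4 * R.N m)) (EuclideanSpace.single 0 1) (EuclideanSpace.single 1 1)) =
        27 * π / 16 * R.N m ^ (R.β - 2) ∧
    R.N m ^ (R.β - 2) ≤ 27 * π / 16 * R.N m ^ (R.β - 2) ∧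
    circulation (fun y : EuclideanSpace ℝ (Fin 3) =>
        ((3 / 2 * R.A m) * Real.smoothTransition (256 / 31 - 400 / 31 * R.N m ^ 2 * ‖y - c‖ ^ 2)) •
          rotGen (y - c))
      (circleLoop c (1 / R.N m) (EuclideanSpace.single 0 1) (EuclideanSpace.single 1 1)) = 0 := by
  have hN := R.N_pos m
  refine ⟨?_, ?_, ?_, ?_, ?_⟩
  · rw [div_le_div_iff₀ (by positivity) (by positivity)]; linarith
  · rw [div_le_div_iff₀ (by positivity) hN]; linarith
  · have hρ1 : (1 : ℝ) ≤ 256 / 31 - 400 / 31 * R.N m ^ 2 * (3 / (4 * R.N m)) ^ 2 := by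
      field_simp; norm_num
    rw [LetterWitness.circulation_field_circleLoop c hρ1, ← R.A_div_N_sq m]
    field_simp
    ring
  · have h1 : 0 < R.N m ^ (R.β - 2) := Real.rpow_pos_of_pos hN _
    nlinarith [Real.pi_gt_three]
  · apply LetterWitness.circulation_field_circleLoop_eq_zero
    have h : 256 / 31 - 400 / 31 * R.N m ^ 2 * (1 / R.N m) ^ 2 = -(144 / 31 : ℝ) := by
      field_simp; ring
    rw [h]; norm_num

end Summit.NavierStokesRegularity.FluidComputer.PalasekTowerClayBridge

end
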